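import Summits.QuantumFields.YangMills.Theorems.ColdStartUniversalityColdStartSolutionsExistTruncated
import Summits.QuantumFields.YangMills.Theorems.ColdStartUniversalityColdStartSolutionsExistAmbientCoordinates
import Summits.QuantumFields.YangMills.Theorems.ColdStartUniversalityColdStartSolutionsExistPicardIntegrals
import Summits.QuantumFields.YangMills.Theorems.ColdStartUniversalityLatticeLangevinUniquenessVec
import HarnessLib

/-!
# Route `ColdStartUniversality` (rung input (E) of crux K_A1, stmt-QuantumFields-24809): PATHWISE
# UNIQUENESS of the SU(2) lattice Langevin dynamics (SZZ Lemma 3.2, uniqueness clause)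

Helper file (seat `ym-line-csu-p1`).  On any probability space carrying a flat Brownian motion `W`, two
solutions (tree `LinkSDE.IsSolution`, raw natural filtration of `W`) of the Shen–Zhu–Zhu system
`latticeLangevinDynamics (SU(2), fundamental) β` on the torus `(ℤ/L)³` with the same deterministic start are
indistinguishable: `latticeLangevin_pathwise_unique`.  This is the uniqueness clause of SZZ arXiv:2204.12737
§3 Lemma 3.2 (tree named fact `LatticeLangevinWellPosed`, instance `r = fundamentalLatticeRep 2`, `d = 3`);
with the cold-start existence theorem `coldStart_solution` (seat g2) it is what the rung input (E) of
`stub_fixedCutoffMixing` presupposes (a mixing time uniform over ALL cold-start solutions).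

Proof: read both solutions in the quaternion coordinates `(Re Q₀₀, Im Q₀₀, Re Q₀₁, Im Q₀₁)` of
`Q = ρ ∘ U ∈ SU(2)^E ⊆ V^E`; along `SU(2)^E` the SZZ coefficients coincide with the tame (globally Lipschitz)
tangent modification `S̃` of `exists_truncatedCoefficients`, so after dyadic regularisation (progressive
versions, tree `dyadicReg`) the coordinates are two bounded solutions of one Lipschitz system driven by the
enumerated Brownian vector, and `vecSDE_pathwise_unique_of_bounded` applies; the chart is injective on `V`
(`quat_eq_of_mem_span`) and `ρ` is injective.

No definition, no sorry.  RECORD-rung R3 plumbing; nothing here bears on the mass gap. -/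

set_option autoImplicit false

noncomputable section

namespace Summit.QuantumFields.YangMills.Theorems.ColdStartUniversality

open MeasureTheory ProbabilityTheory Filter Topology Finset Matrix Complex
open scoped NNReal ENNReal BigOperators ComplexConjugate
open Literature.Probability.Process Literature.Analysis.FunctionSpaces
open Literature.MathematicalPhysics.QuantumFieldTheory
open Literature.MathematicalPhysics.QuantumLattice (fundamentalRep fundamentalLatticeRep continuous_fundamentalRep
  fundamentalRep_injective)

variable {Ω : Type*} {mΩ : MeasurableSpace Ω} {P : Measure Ω} {L : ℕ} [NeZero L]
  {W : ℝ≥0 → Ω → (Edge 3 L × NoiseIdx 2 → ℝ)}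

/-- The four real quaternion coordinates `(Re M₀₀, Im M₀₀, Re M₀₁, Im M₀₁)` depend continuously on the
matrix. [folklore] -/
theorem continuous_quatCoord (a : Fin 4) :
    Continuous fun M : Matrix (Fin 2) (Fin 2) ℂ => (![(M 0 0).re, (M 0 0).im, (M 0 1).re, (M 0 1).im] : Fin 4 → ℝ) a := by
  fin_cases a <;>
    simp only [Fin.zero_eta, Fin.mk_one, Fin.isValue, Fin.reduceFinMk, Matrix.cons_val_zero, Matrix.cons_val_one,
      Matrix.cons_val] <;> fun_prop

/-- Entries of `SU(2)` matrices have real and imaginary parts bounded by `2` (crudely: `‖ρ g‖_F² = 2`).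
[folklore] -/
theorem abs_quatCoord_fundamentalRep_le (g : Matrix.specialUnitaryGroup (Fin 2) ℂ) (a : Fin 4) :
    |(![((fundamentalRep (Fin 2) g) 0 0).re, ((fundamentalRep (Fin 2) g) 0 0).im,
        ((fundamentalRep (Fin 2) g) 0 1).re, ((fundamentalRep (Fin 2) g) 0 1).im] : Fin 4 → ℝ) a| ≤ 2 := by
  have h2 := hsForm_self_fundamentalRep g
  have hb : ∀ x : ℝ, x ^ 2 ≤ hsForm 2 (fundamentalRep (Fin 2) g) (fundamentalRep (Fin 2) g) → |x| ≤ 2 := by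
    intro x hx
    rw [h2] at hx
    exact abs_le.2 ⟨by nlinarith, by nlinarith⟩
  fin_cases a
  · simpa using hb _ (sq_re_le_hsForm _ 0 0)
  · simpa using hb _ (sq_im_le_hsForm _ 0 0)
  · simpa using hb _ (sq_re_le_hsForm _ 0 1)
  · simpa using hb _ (sq_im_le_hsForm _ 0 1)

/-- **Pathwise uniqueness of the `SU(2)` lattice Langevin dynamics** (SZZ Lemma 3.2, uniqueness clause;
`r = fundamentalLatticeRep 2`, `d = 3`): on a probability space with a flat Brownian motion `W`, two solutions
of `latticeLangevinDynamics (fundamentalLatticeRep 2) β` through the fundamental representation, adapted to the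
raw natural filtration of `W`, with the same deterministic initial configuration, are indistinguishable.
[cite: ShenZhuZhu2022, §3 Lemma 3.2 (global well-posedness; p. 13)] -/
theorem latticeLangevin_pathwise_unique [IsProbabilityMeasure P] (hW : IsFlatBrownian W P) (β : ℝ)
    (U₀ : GaugeConfig 3 L (Matrix.specialUnitaryGroup (Fin 2) ℂ))
    {U U' : ℝ≥0 → Ω → GaugeConfig 3 L (Matrix.specialUnitaryGroup (Fin 2) ℂ)}
    (h0 : ∀ ω, U 0 ω = U₀) (h0' : ∀ ω, U' 0 ω = U₀)
    (hU : (latticeLangevinDynamics (fundamentalLatticeRep 2) β).IsSolution (fundamentalRep (Fin 2))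
      hW.natFiltration P W U)
    (hU' : (latticeLangevinDynamics (fundamentalLatticeRep 2) β).IsSolution (fundamentalRep (Fin 2))
      hW.natFiltration P W U') :
    ∀ᵐ ω ∂P, ∀ t, U t ω = U' t ω := by
  classical
  have hfil := natFiltration_flat_eq hW
  -- tame coefficients agreeing with SZZ on the group
  obtain ⟨S, ⟨⟨K, hK⟩, hV⟩, -, hAgree⟩ := exists_truncatedCoefficients L β
  set Kp : ℝ := max K 0 with hKp
  have hKp0 : 0 ≤ Kp := le_max_right _ _
  have hsum0 : ∀ Q Q' : MatrixConfig 3 L 2, 0 ≤ ∑ e', hsForm 2 (Q e' - Q' e') (Q e' - Q' e') := fun Q Q' =>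
    Finset.sum_nonneg fun _ _ => hsForm_self_nonneg _
  have hSd' : ∀ (Q Q' : MatrixConfig 3 L 2) (e : Edge 3 L),
      hsForm 2 (S.drift Q e - S.drift Q' e) (S.drift Q e - S.drift Q' e) ≤
        Kp * ∑ e', hsForm 2 (Q e' - Q' e') (Q e' - Q' e') := fun Q Q' e =>
    ((hK Q Q' e).1).trans (mul_le_mul_of_nonneg_right (le_max_left _ _) (hsum0 Q Q'))
  have hSn' : ∀ (Q Q' : MatrixConfig 3 L 2) (e : Edge 3 L) (n : NoiseIdx 2),
      hsForm 2 (S.noise Q e n - S.noise Q' e n) (S.noise Q e n - S.noise Q' e n) ≤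
        Kp * ∑ e', hsForm 2 (Q e' - Q' e') (Q e' - Q' e') := fun Q Q' e n =>
    ((hK Q Q' e).2 n).trans (mul_le_mul_of_nonneg_right (le_max_left _ _) (hsum0 Q Q'))
  -- the quaternion chart, coordinates, coefficients in coordinates (as in `ambient_exists_of_tame`)
  set Φ : (Edge 3 L × Fin 4 → ℝ) → MatrixConfig 3 L 2 := fun y e =>
    !![((y (e, 0) : ℝ) : ℂ) + ((y (e, 1) : ℝ) : ℂ) * Complex.I, ((y (e, 2) : ℝ) : ℂ) + ((y (e, 3) : ℝ) : ℂ) * Complex.I;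
      -((y (e, 2) : ℝ) : ℂ) + ((y (e, 3) : ℝ) : ℂ) * Complex.I, ((y (e, 0) : ℝ) : ℂ) - ((y (e, 1) : ℝ) : ℂ) * Complex.I]
    with hΦ
  set qc : Matrix (Fin 2) (Fin 2) ℂ → Fin 4 → ℝ := fun M a =>
    (![(M 0 0).re, (M 0 0).im, (M 0 1).re, (M 0 1).im] : Fin 4 → ℝ) a with hqc
  have hqc_cont : ∀ a, Continuous fun M => qc M a := fun a => continuous_quatCoord a
  have hΦqc : ∀ Q : MatrixConfig 3 L 2, (∀ e, Q e ∈ Submodule.span ℝ (Set.range ⇑(fundamentalRep (Fin 2)))) →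
      Φ (fun p => qc (Q p.1) p.2) = Q := by
    intro Q hQ
    funext e
    simp only [hΦ, hqc, Matrix.cons_val_zero, Matrix.cons_val_one, Matrix.cons_val]
    exact quat_eq_of_mem_span (hQ e)
  set bq : (Edge 3 L × Fin 4 → ℝ) → Edge 3 L × Fin 4 → ℝ := fun y p => qc (S.drift (Φ y) p.1) p.2 with hbq
  set sq : (Edge 3 L × Fin 4 → ℝ) → Edge 3 L × Fin 4 → NoiseIdx 2 → ℝ := fun y p n =>
    qc (S.noise (Φ y) p.1 n) p.2 with hsq
  set c : Edge 3 L × Fin 4 → NoiseIdx 2 → Fin (Fintype.card (Edge 3 L × NoiseIdx 2)) := fun p n =>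
    Fintype.equivFin (Edge 3 L × NoiseIdx 2) (p.1, n) with hc
  set x₀ : Edge 3 L × Fin 4 → ℝ := fun p => qc (fundamentalRep (Fin 2) (U₀ p.1)) p.2 with hx₀
  set K' : ℝ := 2 * Kp * (Fintype.card (Edge 3 L)) * (Fintype.card (NoiseIdx 2)) with hK'
  have hK'0 : 0 ≤ K' := by positivity
  have hN1 : (1 : ℝ) ≤ Fintype.card (NoiseIdx 2) := by exact_mod_cast Fintype.card_pos
  -- Lipschitz bounds in coordinates (verbatim from `ambient_exists_of_tame`)
  have hb : ∀ y y' : Edge 3 L × Fin 4 → ℝ, ∑ p, (bq y p - bq y' p) ^ 2 ≤ K' * ∑ p, (y p - y' p) ^ 2 := by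
    intro y y'
    have h1 : ∀ e, ∑ a : Fin 4, (bq y (e, a) - bq y' (e, a)) ^ 2 ≤ 2 * Kp * ∑ p, (y p - y' p) ^ 2 := by
      intro e
      simp only [hbq, hqc, hΦ]
      exact quatCoord_lipschitz (F := fun Q => S.drift Q e) (fun Q Q' => hSd' Q Q' e) y y'
    rw [Fintype.sum_prod_type (fun p : Edge 3 L × Fin 4 => (bq y p - bq y' p) ^ 2)]
    calc ∑ e, ∑ a, (bq y (e, a) - bq y' (e, a)) ^ 2 ≤ ∑ _e : Edge 3 L, 2 * Kp * ∑ p, (y p - y' p) ^ 2 :=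
          Finset.sum_le_sum fun e _ => h1 e
      _ = (Fintype.card (Edge 3 L) : ℝ) * (2 * Kp * ∑ p, (y p - y' p) ^ 2) := by
          rw [Finset.sum_const, Finset.card_univ, nsmul_eq_mul]
      _ ≤ K' * ∑ p, (y p - y' p) ^ 2 := by
          rw [hK']
          have : (Fintype.card (Edge 3 L) : ℝ) * (2 * Kp * ∑ p, (y p - y' p) ^ 2) * 1 ≤
              (Fintype.card (Edge 3 L) : ℝ) * (2 * Kp * ∑ p, (y p - y' p) ^ 2) * Fintype.card (NoiseIdx 2) :=
            mul_le_mul_of_nonneg_left hN1 (by positivity)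
          nlinarith
  have hσ : ∀ y y' : Edge 3 L × Fin 4 → ℝ,
      ∑ p, ∑ n, (sq y p n - sq y' p n) ^ 2 ≤ K' * ∑ p, (y p - y' p) ^ 2 := by
    intro y y'
    have h1 : ∀ e n, ∑ a : Fin 4, (sq y (e, a) n - sq y' (e, a) n) ^ 2 ≤ 2 * Kp * ∑ p, (y p - y' p) ^ 2 := by
      intro e n
      simp only [hsq, hqc, hΦ]
      exact quatCoord_lipschitz (F := fun Q => S.noise Q e n) (fun Q Q' => hSn' Q Q' e n) y y'
    rw [Fintype.sum_prod_type (fun p : Edge 3 L × Fin 4 => ∑ n, (sq y p n - sq y' p n) ^ 2)]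
    calc ∑ e, ∑ a, ∑ n, (sq y (e, a) n - sq y' (e, a) n) ^ 2
        = ∑ e, ∑ n, ∑ a, (sq y (e, a) n - sq y' (e, a) n) ^ 2 :=
          Finset.sum_congr rfl fun e _ => Finset.sum_comm
      _ ≤ ∑ _e : Edge 3 L, ∑ _n : NoiseIdx 2, 2 * Kp * ∑ p, (y p - y' p) ^ 2 :=
          Finset.sum_le_sum fun e _ => Finset.sum_le_sum fun n _ => h1 e n
      _ = K' * ∑ p, (y p - y' p) ^ 2 := by
          rw [Finset.sum_const, Finset.sum_const, Finset.card_univ, Finset.card_univ, nsmul_eq_mul,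
            nsmul_eq_mul, hK']
          ring
  -- reading a solution in regularised quaternion coordinates
  have hcoord : ∀ (X : ℝ≥0 → Ω → GaugeConfig 3 L (Matrix.specialUnitaryGroup (Fin 2) ℂ)),
      (∀ ω, X 0 ω = U₀) →
      (latticeLangevinDynamics (fundamentalLatticeRep 2) β).IsSolution (fundamentalRep (Fin 2))
        hW.natFiltration P W X →
      ∃ (Y : Edge 3 L × Fin 4 → ℝ≥0 → Ω → ℝ) (JY : Edge 3 L × Fin 4 → NoiseIdx 2 → ℝ≥0 → Ω → ℝ),
        (∀ p, IsStronglyProgressive (IsBrownianVec.natFiltration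
          (W := fun t ω k => W t ω ((Fintype.equivFin (Edge 3 L × NoiseIdx 2)).symm k)) hW) (Y p)) ∧
        (∀ᵐ ω ∂P, ∀ p, Continuous fun t => Y p t ω) ∧
        (∀ p n, IsItoIntegral (fun s ω => sq (fun j => Y j s ω) p n)
          (fun s ω => (fun k => W s ω ((Fintype.equivFin (Edge 3 L × NoiseIdx 2)).symm k)) (c p n)) (JY p n)
          (IsBrownianVec.natFiltration
            (W := fun t ω k => W t ω ((Fintype.equivFin (Edge 3 L × NoiseIdx 2)).symm k)) hW) P) ∧
        (∀ᵐ ω ∂P, ∀ (t : ℝ≥0) (p : Edge 3 L × Fin 4),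
          Y p t ω = x₀ p + (∫ s in (0 : ℝ)..t, bq (fun j => Y j s.toNNReal ω) p) + ∑ n, JY p n t ω) ∧
        (∀ᵐ ω ∂P, ∀ (t : ℝ≥0) (p : Edge 3 L × Fin 4), |Y p t ω| ≤ 2) ∧
        ∀ᵐ ω ∂P, ∀ (t : ℝ≥0) (p : Edge 3 L × Fin 4), Y p t ω = qc (fundamentalRep (Fin 2) (X t ω p.1)) p.2 := by
    intro X hX0 hX
    obtain ⟨J, hJC, hXeq⟩ := hX.exists_ito
    -- raw coordinates and their dyadic regularisation
    set y : Edge 3 L × Fin 4 → ℝ≥0 → Ω → ℝ := fun p t ω => qc (fundamentalRep (Fin 2) (X t ω p.1)) p.2 with hy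
    have hya : ∀ p, Adapted hW.natFiltration (y p) := by
      intro p t
      exact (((hqc_cont p.2).comp (continuous_fundamentalRep (Fin 2))).measurable.comp
        (measurable_pi_apply p.1)).comp (hX.adapted t)
    have hyc : ∀ᵐ ω ∂P, ∀ p, Continuous fun t => y p t ω := by
      filter_upwards [hX.continuous] with ω hω p
      exact (hqc_cont p.2).comp ((continuous_fundamentalRep (Fin 2)).comp ((continuous_apply p.1).comp hω))
    set Y : Edge 3 L × Fin 4 → ℝ≥0 → Ω → ℝ := fun p => dyadicReg (y p) with hYdef
    have hYy : ∀ᵐ ω ∂P, ∀ (t : ℝ≥0) (p : Edge 3 L × Fin 4), Y p t ω = y p t ω := by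
      filter_upwards [hyc] with ω hω t p
      exact dyadicReg_apply_of_continuous (hω p) t
    have hYp : ∀ p, IsStronglyProgressive hW.natFiltration (Y p) := fun p => isStronglyProgressive_dyadicReg (hya p)
    have hYc : ∀ᵐ ω ∂P, ∀ p, Continuous fun t => Y p t ω := by
      filter_upwards [hYy, hyc] with ω h1 h2 p
      have : (fun t => Y p t ω) = fun t => y p t ω := funext fun t => h1 t p
      rw [this]; exact h2 p
    -- the chart along the solution: `Φ (y · t ω) = ρ ∘ X t ω`
    have hmem : ∀ t ω e, (fundamentalRep (Fin 2) (X t ω e) : Matrix (Fin 2) (Fin 2) ℂ) ∈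
        Submodule.span ℝ (Set.range ⇑(fundamentalRep (Fin 2))) := fun t ω e => Submodule.subset_span ⟨_, rfl⟩
    have hΦy : ∀ t ω, Φ (fun p => y p t ω) = matrixConfig (fundamentalRep (Fin 2)) (X t ω) := by
      intro t ω
      exact hΦqc (matrixConfig (fundamentalRep (Fin 2)) (X t ω)) (fun e => hmem t ω e)
    -- coefficients along the solution
    have hnoise : ∀ᵐ ω ∂P, ∀ (t : ℝ≥0) (p : Edge 3 L × Fin 4) (n : NoiseIdx 2),
        qc ((latticeLangevinDynamics (fundamentalLatticeRep 2) β).noise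
          (matrixConfig (fundamentalRep (Fin 2)) (X t ω)) p.1 n) p.2 = sq (fun j => Y j t ω) p n := by
      filter_upwards [hYy] with ω hω t p n
      have hY' : (fun j => Y j t ω) = fun j => y j t ω := funext fun j => hω t j
      rw [hsq, hY']
      simp only
      rw [hΦy t ω, ((hAgree (X t ω) p.1).2 n)]
    have hdrift : ∀ᵐ ω ∂P, ∀ (t : ℝ≥0) (p : Edge 3 L × Fin 4),
        qc ((latticeLangevinDynamics (fundamentalLatticeRep 2) β).drift
          (matrixConfig (fundamentalRep (Fin 2)) (X t ω)) p.1) p.2 = bq (fun j => Y j t ω) p := by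
      filter_upwards [hYy] with ω hω t p
      have hY' : (fun j => Y j t ω) = fun j => y j t ω := funext fun j => hω t j
      rw [hbq, hY']
      simp only
      rw [hΦy t ω, (hAgree (X t ω) p.1).1]
    -- the Itô integrals in coordinates
    set JY : Edge 3 L × Fin 4 → NoiseIdx 2 → ℝ≥0 → Ω → ℝ := fun p n t ω =>
      qc (fun i j => J p.1 n i j t ω) p.2 with hJY
    have hJYito : ∀ p n, IsItoIntegral (fun s ω => sq (fun j => Y j s ω) p n)
        (fun s ω => (fun k => W s ω ((Fintype.equivFin (Edge 3 L × NoiseIdx 2)).symm k)) (c p n)) (JY p n)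
        hW.natFiltration P := by
      rintro ⟨e, a⟩ n
      have hB : (fun (s : ℝ≥0) ω => (fun k => W s ω ((Fintype.equivFin (Edge 3 L × NoiseIdx 2)).symm k)) (c (e, a) n)) =
          fun s ω => W s ω (e, n) := by
        funext s ω; simp only [hc, Equiv.symm_apply_apply]
      rw [hB]
      have hae : ∀ b : Fin 4, ∀ᵐ ω ∂P, ∀ t,
          qc (fun i j => (latticeLangevinDynamics (fundamentalLatticeRep 2) β).noise
            (matrixConfig (fundamentalRep (Fin 2)) (X t ω)) e n i j) b = sq (fun j => Y j t ω) (e, b) n := fun b => by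
        filter_upwards [hnoise] with ω hω t
        exact hω t (e, b) n
      have h00 := hJC e n (0 : Fin 2) (0 : Fin 2)
      have h01 := hJC e n (0 : Fin 2) (1 : Fin 2)
      fin_cases a
      · exact (h00.1).congr_integrand_ae (by
          filter_upwards [hae 0] with ω hω t; simpa [hqc] using hω t)
      · exact (h00.2).congr_integrand_ae (by
          filter_upwards [hae 1] with ω hω t; simpa [hqc] using hω t)
      · exact (h01.1).congr_integrand_ae (by
          filter_upwards [hae 2] with ω hω t; simpa [hqc] using hω t)
      · exact (h01.2).congr_integrand_ae (by
          filter_upwards [hae 3] with ω hω t; simpa [hqc] using hω t)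
    -- the integral equations in coordinates
    have hSdc : ∀ e, Continuous fun Q : MatrixConfig 3 L 2 => S.drift Q e := fun e =>
      continuous_of_hsForm_lipschitz fun Q Q' => hSd' Q Q' e
    have hYeq : ∀ᵐ ω ∂P, ∀ (t : ℝ≥0) (p : Edge 3 L × Fin 4),
        Y p t ω = x₀ p + (∫ s in (0 : ℝ)..t, bq (fun j => Y j s.toNNReal ω) p) + ∑ n, JY p n t ω := by
      filter_upwards [hXeq, hYy, hdrift, hX.continuous] with ω hω hYω hdω hcω t p
      obtain ⟨e, a⟩ := p
      -- the drift entries along the path are continuous, hence interval integrable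
      have hpath : Continuous fun s : ℝ => S.drift (matrixConfig (fundamentalRep (Fin 2)) (X s.toNNReal ω)) e := by
        refine (hSdc e).comp ?_
        exact (continuous_pi fun e' => (continuous_fundamentalRep (Fin 2)).comp
          ((continuous_apply e').comp hcω)).comp continuous_real_toNNReal
      have hdr : ∀ s : ℝ, (latticeLangevinDynamics (fundamentalLatticeRep 2) β).drift
          (matrixConfig (fundamentalRep (Fin 2)) (X s.toNNReal ω)) e =
            S.drift (matrixConfig (fundamentalRep (Fin 2)) (X s.toNNReal ω)) e := fun s =>
        ((hAgree (X s.toNNReal ω) e).1).symm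
      have hint : ∀ i' j' : Fin 2, IntervalIntegrable (fun s : ℝ =>
          (latticeLangevinDynamics (fundamentalLatticeRep 2) β).drift
            (matrixConfig (fundamentalRep (Fin 2)) (X s.toNNReal ω)) e i' j') volume 0 t := fun i' j' => by
        simp_rw [hdr]
        exact (((continuous_apply j').comp (continuous_apply i')).comp hpath).intervalIntegrable _ _
      have hre : ∀ i' j' : Fin 2, (∫ s in (0 : ℝ)..t, (latticeLangevinDynamics (fundamentalLatticeRep 2) β).drift
            (matrixConfig (fundamentalRep (Fin 2)) (X s.toNNReal ω)) e i' j').re =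
          ∫ s in (0 : ℝ)..t, ((latticeLangevinDynamics (fundamentalLatticeRep 2) β).drift
            (matrixConfig (fundamentalRep (Fin 2)) (X s.toNNReal ω)) e i' j').re := fun i' j' => by
        have h := intervalIntegral.intervalIntegral_re (hint i' j')
        simpa using h.symm
      have him : ∀ i' j' : Fin 2, (∫ s in (0 : ℝ)..t, (latticeLangevinDynamics (fundamentalLatticeRep 2) β).drift
            (matrixConfig (fundamentalRep (Fin 2)) (X s.toNNReal ω)) e i' j').im =
          ∫ s in (0 : ℝ)..t, ((latticeLangevinDynamics (fundamentalLatticeRep 2) β).drift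
            (matrixConfig (fundamentalRep (Fin 2)) (X s.toNNReal ω)) e i' j').im := fun i' j' => by
        have h := intervalIntegral.intervalIntegral_im (hint i' j')
        simpa using h.symm
      -- the drift integrand in coordinates
      have hbq' : ∀ (s : ℝ) (b : Fin 4), bq (fun j => Y j s.toNNReal ω) (e, b) =
          qc ((latticeLangevinDynamics (fundamentalLatticeRep 2) β).drift
            (matrixConfig (fundamentalRep (Fin 2)) (X s.toNNReal ω)) e) b := fun s b => (hdω s.toNNReal (e, b)).symm
      have hmain : ∀ i' j' : Fin 2,
          (fundamentalRep (Fin 2) (X t ω e) : Matrix (Fin 2) (Fin 2) ℂ) i' j' =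
            (fundamentalRep (Fin 2) (U₀ e) : Matrix (Fin 2) (Fin 2) ℂ) i' j' +
              (∫ s in (0 : ℝ)..t, (latticeLangevinDynamics (fundamentalLatticeRep 2) β).drift
                (matrixConfig (fundamentalRep (Fin 2)) (X s.toNNReal ω)) e i' j') +
              ∑ n, J e n i' j' t ω := by
        intro i' j'
        have h := hω t e i' j'
        rw [hX0 ω] at h
        exact h
      have key : ∀ i' j' : Fin 2,
          (((fundamentalRep (Fin 2) (X t ω e) : Matrix (Fin 2) (Fin 2) ℂ) i' j').re =
            ((fundamentalRep (Fin 2) (U₀ e) : Matrix (Fin 2) (Fin 2) ℂ) i' j').re +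
              (∫ s in (0 : ℝ)..t, ((latticeLangevinDynamics (fundamentalLatticeRep 2) β).drift
                (matrixConfig (fundamentalRep (Fin 2)) (X s.toNNReal ω)) e i' j').re) +
              ∑ n, (J e n i' j' t ω).re) ∧
          (((fundamentalRep (Fin 2) (X t ω e) : Matrix (Fin 2) (Fin 2) ℂ) i' j').im =
            ((fundamentalRep (Fin 2) (U₀ e) : Matrix (Fin 2) (Fin 2) ℂ) i' j').im +
              (∫ s in (0 : ℝ)..t, ((latticeLangevinDynamics (fundamentalLatticeRep 2) β).drift
                (matrixConfig (fundamentalRep (Fin 2)) (X s.toNNReal ω)) e i' j').im) +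
              ∑ n, (J e n i' j' t ω).im) := by
        intro i' j'
        refine ⟨?_, ?_⟩
        · have h := congrArg Complex.re (hmain i' j')
          rw [Complex.add_re, Complex.add_re, Complex.re_sum, hre i' j'] at h
          exact h
        · have h := congrArg Complex.im (hmain i' j')
          rw [Complex.add_im, Complex.add_im, Complex.im_sum, him i' j'] at h
          exact h
      rw [hYω t (e, a)]
      simp_rw [hbq']
      fin_cases a <;>
        simp only [hy, hJY, hx₀, hqc, Fin.zero_eta, Fin.mk_one, Fin.isValue, Fin.reduceFinMk, Matrix.cons_val_zero,
          Matrix.cons_val_one, Matrix.cons_val]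
      · exact (key 0 0).1
      · exact (key 0 0).2
      · exact (key 0 1).1
      · exact (key 0 1).2
    -- boundedness
    have hYbd : ∀ᵐ ω ∂P, ∀ (t : ℝ≥0) (p : Edge 3 L × Fin 4), |Y p t ω| ≤ 2 := by
      filter_upwards [hYy] with ω hω t p
      rw [hω t p, hy]
      exact abs_quatCoord_fundamentalRep_le (X t ω p.1) p.2
    refine ⟨Y, JY, fun p => hfil ▸ hYp p, hYc, fun p n => hfil ▸ hJYito p n, hYeq, hYbd, hYy⟩
  -- apply the generic uniqueness theorem to the two coordinate processes
  obtain ⟨Y, JY, hYp, hYc, hJY, hYeq, hYbd, hYy⟩ := hcoord U h0 hU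
  obtain ⟨Y', JY', hY'p, hY'c, hJY', hY'eq, hY'bd, hY'y⟩ := hcoord U' h0' hU'
  have huniq := vecSDE_pathwise_unique_of_bounded (x₀ := x₀) (M := 2) hW hK'0 hb hσ hYp hYc hY'p hY'c hJY hJY'
    hYeq hY'eq (by filter_upwards [hYbd, hY'bd] with ω h h' t i; exact ⟨h t i, h' t i⟩)
  filter_upwards [huniq, hYy, hY'y] with ω hω hy hy' t
  funext e
  apply fundamentalRep_injective (Fin 2)
  have hq : ∀ a : Fin 4, qc (fundamentalRep (Fin 2) (U t ω e)) a = qc (fundamentalRep (Fin 2) (U' t ω e)) a :=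
    fun a => by rw [← hy t (e, a), ← hy' t (e, a), hω t (e, a)]
  have h1 := hΦqc (matrixConfig (fundamentalRep (Fin 2)) (U t ω))
    (fun e' => Submodule.subset_span ⟨_, rfl⟩)
  have h2 := hΦqc (matrixConfig (fundamentalRep (Fin 2)) (U' t ω))
    (fun e' => Submodule.subset_span ⟨_, rfl⟩)
  have h1e := congrFun h1 e
  have h2e := congrFun h2 e
  simp only [matrixConfig] at h1e h2e
  rw [← h1e, ← h2e]
  simp only [hΦ, hq]

end Summit.QuantumFields.YangMills.Theorems.ColdStartUniversality

end
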